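import Summits.HodgeConjecture.HodgeConjecture.Theses.TropicalKugaSatakeCayley
import HarnessLib

/-!
# Assembly of route `TropicalKugaSatakeCayley` (stmt-HodgeConjecture-18574)

The assembly item of the refutation route `TropicalKugaSatakeCayley` is pure logic over its five
items plus one measure-theoretic lemma (the "Baire" step the planner left to the prover of this
item): **every non-empty open subset of `ℝ⁵` contains a point with `ℚ`-linearly independent
coordinates** (`exists_mem_linearIndependent_rat_of_isOpen`: the `ℚ`-linearly dependent vectors lie
in the countable union of the proper hyperplanes `∑ qᵢ tᵢ = 0`, `q ∈ ℚ⁵ ∖ {0}`, each Lebesgue-null by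
`Measure.addHaar_submodule`, while a non-empty open set has positive Lebesgue measure).

The assembly (`tropicalKugaSatakeCayley_assembly_proof`): assume HC; `KontsevichTransferKS` gives
the cusp datum `z`; `KSModelExists` a Kuga–Satake model `(Φ, X, φ)` at `z`; `CayleyHodgeRankTwo` two
`ℂ`-independent rational `(6,6)`-classes on the smooth projective eightfold `X`, algebraic by HC;
`KontsevichTransferKS` (with `a = 2`) an open `U ≠ ∅` in the positive cone carrying, at every
`t ∈ U`, two effective tropical `2`-cycles with `ℝ`-independent period classes; at a `ℚ`-generic
`t ∈ U` (the lemma) `FormalCycleCriterion` spreads each cycle over an open set with constant class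
and `EffectiveCayleyNonRealizability` makes each class a real multiple of `1`; two multiples of `1`
are `ℝ`-dependent — contradiction.
-/

set_option linter.dupNamespace false

noncomputable section

namespace Summit.HodgeConjecture.HodgeConjecture.Theorems

open MeasureTheory

/-- **A non-empty open subset of `ℝ⁵` contains a point with `ℚ`-linearly independent coordinates.**
The complement — the `ℚ`-linearly dependent vectors — is contained in `⋃_{q ∈ ℚ⁵ ∖ {0}} ker (∑ qᵢ prᵢ)`,
a countable union of proper linear subspaces, hence Lebesgue-null (`Measure.addHaar_submodule`),
while non-empty open sets have positive Lebesgue measure (`IsOpen.measure_pos`). -/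
theorem exists_mem_linearIndependent_rat_of_isOpen {U : Set (Fin 5 → ℝ)} (hU : IsOpen U)
    (hne : U.Nonempty) : ∃ t ∈ U, LinearIndependent ℚ t := by
  classical
  -- the hyperplanes `∑ qᵢ tᵢ = 0`
  let H : (Fin 5 → ℚ) → Submodule ℝ (Fin 5 → ℝ) := fun q ↦
    LinearMap.ker (∑ i, (q i : ℝ) • LinearMap.proj i)
  have hmemH : ∀ (q : Fin 5 → ℚ) (t : Fin 5 → ℝ), t ∈ H q ↔ ∑ i, (q i : ℝ) * t i = 0 := by
    intro q t
    simp only [H, LinearMap.mem_ker, LinearMap.coe_sum, Finset.sum_apply, LinearMap.smul_apply,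
      LinearMap.coe_proj, Function.eval, smul_eq_mul]
  have hH : ∀ q : Fin 5 → ℚ, q ≠ 0 → H q ≠ ⊤ := by
    intro q hq htop
    obtain ⟨i, hi⟩ := Function.ne_iff.mp hq
    have hmem : (Pi.single i (1 : ℝ) : Fin 5 → ℝ) ∈ H q := htop ▸ Submodule.mem_top
    rw [hmemH] at hmem
    simp only [Pi.single_apply, mul_ite, mul_one, mul_zero, Finset.sum_ite_eq',
      Finset.mem_univ, if_true, Rat.cast_eq_zero] at hmem
    exact hi hmem
  have hnull : volume (⋃ q ∈ {q : Fin 5 → ℚ | q ≠ 0}, (H q : Set (Fin 5 → ℝ))) = 0 := by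
    refine (measure_biUnion_null_iff (Set.to_countable _)).mpr ?_
    intro q hq
    exact Measure.addHaar_submodule volume (H q) (hH q hq)
  have hpos : 0 < volume U := hU.measure_pos volume hne
  have hnot : ¬ U ⊆ ⋃ q ∈ {q : Fin 5 → ℚ | q ≠ 0}, (H q : Set (Fin 5 → ℝ)) :=
    fun hsub ↦ hpos.ne' (measure_mono_null hsub hnull)
  obtain ⟨t, htU, ht⟩ := Set.not_subset.mp hnot
  refine ⟨t, htU, ?_⟩
  rw [Fintype.linearIndependent_iff]
  intro g hg
  by_contra hg0
  push Not at hg0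
  apply ht
  refine Set.mem_iUnion₂.mpr ⟨g, ?_, ?_⟩
  · intro h0
    obtain ⟨i, hi⟩ := hg0
    exact hi (congrFun h0 i)
  · show t ∈ (H g : Set (Fin 5 → ℝ))
    rw [SetLike.mem_coe, hmemH]
    simpa only [Rat.smul_def] using hg

open Literature.AlgebraicGeometry.Tropical in
/-- **Assembly of route `TropicalKugaSatakeCayley`** (item stmt-HodgeConjecture-18574):
`EffectiveCayleyNonRealizability → KontsevichTransferKS → FormalCycleCriterion → KSModelExists →
CayleyHodgeRankTwo → ¬ HodgeConjecture`. See the module docstring; the only non-logical step is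
`exists_mem_linearIndependent_rat_of_isOpen`. -/
theorem tropicalKugaSatakeCayley_assembly_proof :
    Summit.HodgeConjecture.HodgeConjecture.Theses.TropicalKugaSatakeCayley.Assembly := by
  intro h₁ h₂ h₃ s₃ s₅ hHC
  obtain ⟨z, hz, hK2⟩ := h₂
  obtain ⟨Φ, hΦ, X, hX, φ, hφ⟩ := s₃ z hz
  obtain ⟨c, hcr, hct, hci⟩ := s₅ z hz Φ hΦ X hX φ hφ
  have halg : ∀ i, c i ∈ Literature.AlgebraicGeometry.HodgeTheory.algebraicClasses X 6 :=
    fun i ↦ (hHC hX).2 6 (c i) (hcr i) (hct i)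
  obtain ⟨U, hUo, hUne, hUcone, hU⟩ :=
    hK2 Φ hΦ X hX φ hφ 2 c hci (fun i ↦ ⟨hcr i, hct i, halg i⟩)
  obtain ⟨t, htU, htq⟩ := exists_mem_linearIndependent_rat_of_isOpen hUo hUne
  obtain ⟨Z, hZ, hZi⟩ := hU t htU
  -- at the `ℚ`-generic `t` each period class is a real multiple of `1`
  have hmul : ∀ i, ∃ r : ℝ,
      TropicalTorus.compound 2 (ksMatrix t)⁻¹ * (Z i).classOf =
        r • (1 : Matrix (TropicalTorus.Sub 8 2) (TropicalTorus.Sub 8 2) ℝ) := by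
    intro i
    obtain ⟨Ui, hUio, hUine, hUicone, hUi⟩ := h₃ t (hUcone htU) htq (Z i) (hZ i).1 (hZ i).2
    exact h₁ Ui hUio hUine hUicone _ hUi
  choose r hr using hmul
  -- two multiples of `1` are `ℝ`-linearly dependent
  have h0 : r 0 ≠ 0 := by
    intro h00
    apply hZi.ne_zero 0
    rw [hr 0, h00, zero_smul]
  rw [Fintype.linearIndependent_iff] at hZi
  have key := hZi ![r 1, -r 0] (by
    rw [Fin.sum_univ_two, hr 0, hr 1]
    simp only [Matrix.cons_val_zero, Matrix.cons_val_one, smul_smul, neg_mul,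
      neg_smul, mul_comm (r 1) (r 0), add_neg_cancel]) 1
  simp only [Matrix.cons_val_one, Matrix.cons_val_fin_one, neg_eq_zero] at key
  exact h0 key

end Summit.HodgeConjecture.HodgeConjecture.Theorems

end
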